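import Summits.AtomisticToContinuum.Crystallization.Theorems.FrustratedLawDichotomyStrainedPatchHomEntryFitHcpSharpEta
import Summits.AtomisticToContinuum.Crystallization.Theorems.FrustratedLawDichotomyStrainedPatchHomEntryFitCentredReal
import Summits.AtomisticToContinuum.Crystallization.Theorems.FrustratedLawDichotomyStrainedPatchHomCurvCentreKit
import Summits.AtomisticToContinuum.Crystallization.Theorems.FrustratedLawDichotomyStrainedPatchHomEntrySymBox

/-!
# The DIRECTIONAL CENTRED hcp fit verdict `fitOKHD` (kit): kernel data instantiating `…HomEntryFitCentredReal.pairResidual_le`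
# (27623 `(H) HomFloor (1/625)`, hcp half; critic row 1147 budget gate branch 3; hand-1 g30 FINDING §3 (iii) / §5)

decomp-a2c hand-1 g30 (crux `AperiodicFrustratedLawGap`, stmt-AtomisticToContinuum-27623).  The pair misfit `‖R_k − δ_{k′} n_k‖` of the (P1) fit on an
entry/shuffle box `(c, w)` is bounded here by CENTRE VALUE + exact FIRST-ORDER functional + second-order remainders (`pairResidual_le`): the centre data
`R_k(U_c, ξ_c)`, `δ_{k′}(U_c, ξ_c)` are the existing `…HomEntryFitHcpSharpKit` enclosures on the ZERO-width box (`…HomCurvCentreKit.zW`, centre operator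
`cenMap c`, centre shuffle `cenShuf c`); the variation `ΔR_k = D·m_k(ξ) + [s_k]·U_c Δξ` (`D = U − U_c`, entries in `[−w, w]`; `m_k = n_k + [s_k] ξ`) is
enclosed in Cartesian components from the offset box; the first-order functional `⟪ê, ΔR_k⟫ − ⟪ê, n_k⟫·⟪ĝ, ΔR_{k′}⟫` (`ê = r_c/‖r_c‖`, `ĝ = N_c/‖N_c‖`)
is evaluated with the coefficient of each `D_ab` COMBINED before the box interval multiplies it — this is where a uniform dilation cancels and the excess
drops from `≈ 9` to `≈ 2–3` misfit units per unit entry half-width (float model `centred.py`: worst-ray crossover `2^-11.75` vs `2⁻¹³` for `fitOKHSE`).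

* §1 box intervals `wdFI`, `wxFI`, `absFI`, `sum3` (+ `mem` lemmas); §2 centre data `cE0 cX0 cRc cDlt cRcv cRcN cNc cNcN`; §3 variation `cM cUdx cDR cRho`;
* §4 directional data `cEh cGh cEn`, the first-order functional `cTU`/`cTX`, the pair bounds `cPairCore`/`cPairC` (centred) and `cPairT` (guard-free triangle bound
  `‖r_c‖ + ρ_k + ρ_{k′}`), the test `cTest`/`cPairOK`, and ★ the verdict `fitOKHD c w` (= `fitOKHSE` with the pair test replaced).
Soundness (`fitOKHD_sound`) is the sequel `…HomEntryFitHcpCentred`.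

All definitions computable; 0 sorry; standard axioms; no instances / notation / `#eval`.  `--supports stmt-AtomisticToContinuum-27623`.
-/

namespace Summit.AtomisticToContinuum.Crystallization.Theorems.FrustratedLawDichotomyStrainedPatchHomEntryFitHcpCentred

open scoped BigOperators RealInnerProductSpace
open Literature.Analysis.ValidatedNumerics.Numerics
open Summit.AtomisticToContinuum.Crystallization.Theorems.ChargedEnergyGapNegative (E3)
open Summit.AtomisticToContinuum.Crystallization.Theorems.FrustratedLawDichotomyStrainedPatchHomEntryGram (entryFI mem_entryFI)
open Summit.AtomisticToContinuum.Crystallization.Theorems.FrustratedLawDichotomyStrainedPatchHomEntryGramHcp (dot3 shufFI mem_dot3 mem_shufFI)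
open Summit.AtomisticToContinuum.Crystallization.Theorems.FrustratedLawDichotomyStrainedPatchHomEntryFit (scaleL devFI lmax)
open Summit.AtomisticToContinuum.Crystallization.Theorems.FrustratedLawDichotomyStrainedPatchHomEntryFitKit (lmin)
open Summit.AtomisticToContinuum.Crystallization.Theorems.FrustratedLawDichotomyStrainedPatchHomEntryHcpFrame (hlab hshift nbr)
open Summit.AtomisticToContinuum.Crystallization.Theorems.FrustratedLawDichotomyStrainedPatchHomEntryFitHcpKit (dEnclH nbrSq xiSq box7all qform13 extU K12H)
open Summit.AtomisticToContinuum.Crystallization.Theorems.FrustratedLawDichotomyStrainedPatchHomEntryFitHcpSharpKit (nbrFI rVec nrm2 dlt devH d2S)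
open Summit.AtomisticToContinuum.Crystallization.Theorems.FrustratedLawDichotomyStrainedPatchHomCurvCentreKit (zW)

/-! ## §1. Box intervals -/

/-- The symmetric interval `[−w_ab, w_ab]` of the entry offset `D_ab = U_ab − c_ab/SC`. -/
def wdFI (w : (Fin 3 × Fin 3) ⊕ Fin 3 → ℤ) (ab : Fin 3 × Fin 3) : FI := ⟨-w (Sum.inl ab), w (Sum.inl ab)⟩

/-- The symmetric interval `[−w_b, w_b]` of the shuffle offset `ξ_b − ξ_{c,b}`. -/
def wxFI (w : (Fin 3 × Fin 3) ⊕ Fin 3 → ℤ) (b : Fin 3) : FI := ⟨-w (Sum.inr b), w (Sum.inr b)⟩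

/-- A symmetric enclosure of `|x|` (and of `x`) from an enclosure of `x`. -/
def absFI (I : FI) : FI := ⟨-I.absHi, I.absHi⟩

/-- `|x| ∈ absFI I` for `x ∈ I`. [formal bookkeeping] -/
theorem mem_absFI {x : ℝ} {I : FI} (h : FI.mem x I) : FI.mem |x| (absFI I) := by
  obtain ⟨h1, h2⟩ := FI.mem_def.1 h
  have hS : (0 : ℝ) < SC := by norm_num [SC]
  have hA : (((I.absHi : ℤ) : ℝ)) = max |((I.lo : ℤ) : ℝ)| |((I.hi : ℤ) : ℝ)| := by
    show (((max |I.lo| |I.hi| : ℤ)) : ℝ) = _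
    push_cast
    rfl
  have key : |x * SC| ≤ max |((I.lo : ℤ) : ℝ)| |((I.hi : ℤ) : ℝ)| := abs_le_max_abs_abs h1 h2
  have e : |x| * SC = |x * SC| := by rw [abs_mul, abs_of_pos hS]
  refine FI.mem_def.2 ⟨?_, ?_⟩
  · show (((-I.absHi : ℤ)) : ℝ) ≤ |x| * SC
    push_cast
    rw [hA]
    nlinarith [abs_nonneg x, (abs_nonneg _ : (0:ℝ) ≤ |((I.lo : ℤ) : ℝ)|), le_max_left |((I.lo : ℤ) : ℝ)| |((I.hi : ℤ) : ℝ)|]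
  · show |x| * SC ≤ ((I.absHi : ℤ) : ℝ)
    rw [hA, e]
    exact key

/-- Sum of three intervals. -/
def sum3 (f : Fin 3 → FI) : FI := ((f 0).add (f 1)).add (f 2)

/-- `sum3` encloses a three-term sum. [formal bookkeeping] -/
theorem mem_sum3 {x : Fin 3 → ℝ} {f : Fin 3 → FI} (h : ∀ a, FI.mem (x a) (f a)) : FI.mem (∑ a : Fin 3, x a) (sum3 f) := by
  rw [Fin.sum_univ_three]
  exact FI.mem_add (FI.mem_add (h 0) (h 1)) (h 2)

/-! ## §2. Centre data (zero-width box at the cell centre) -/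

/-- Deviation entries of `V_c = U_c − λ·1` (thin). -/
def cE0 (c : (Fin 3 × Fin 3) ⊕ Fin 3 → ℤ) (L : ℤ) : Fin 3 × Fin 3 → FI := devH c zW L

/-- The centre shuffle `ξ_c` (thin). -/
def cX0 (c : (Fin 3 × Fin 3) ⊕ Fin 3 → ℤ) : Fin 3 → FI := shufFI c zW

/-- `R_k(U_c, ξ_c)` components. -/
def cRc (c : (Fin 3 × Fin 3) ⊕ Fin 3 → ℤ) (L : ℤ) (k : Fin 12) (a : Fin 3) : FI := rVec (cE0 c L) (cX0 c) (FI.ofScaled L) k a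

/-- `δ_{k′}(U_c, ξ_c) = ‖N_{k′}(U_c,ξ_c)‖ − λ`. -/
def cDlt (c : (Fin 3 × Fin 3) ⊕ Fin 3 → ℤ) (L : ℤ) (k' : Fin 12) : FI := dlt (cE0 c L) (cX0 c) (FI.ofScaled L) k'

/-- The centre pair residual `r_c = R_k(c) − δ_{k′}(c)·n_k`, components. -/
def cRcv (c : (Fin 3 × Fin 3) ⊕ Fin 3 → ℤ) (L : ℤ) (k k' : Fin 12) (a : Fin 3) : FI := (cRc c L k a).sub ((cDlt c L k').mul (nbrFI k a))

/-- `‖r_c‖`. -/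
def cRcN (c : (Fin 3 × Fin 3) ⊕ Fin 3 → ℤ) (L : ℤ) (k k' : Fin 12) : FI := FI.sqrt (dot3 (cRcv c L k k') (cRcv c L k k'))

/-- `N_{k′}(U_c, ξ_c) = λ n_{k′} + R_{k′}(c)`, components. -/
def cNc (c : (Fin 3 × Fin 3) ⊕ Fin 3 → ℤ) (L : ℤ) (k' : Fin 12) (a : Fin 3) : FI := ((FI.ofScaled L).mul (nbrFI k' a)).add (cRc c L k' a)

/-- `‖N_{k′}(U_c, ξ_c)‖`. -/
def cNcN (c : (Fin 3 × Fin 3) ⊕ Fin 3 → ℤ) (L : ℤ) (k' : Fin 12) : FI := FI.sqrt (nrm2 (cE0 c L) (cX0 c) (FI.ofScaled L) k')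

/-! ## §3. Variation over the box -/

/-- `m_k(ξ) = n_k + [s_k] ξ` over the shuffle box, components. -/
def cM (c w : (Fin 3 × Fin 3) ⊕ Fin 3 → ℤ) (k : Fin 12) (b : Fin 3) : FI := (nbrFI k b).add (if hshift k then shufFI c w b else FI.ofInt 0)

/-- `(U_c Δξ)_a = Σ_b (c_ab/SC)·Δξ_b` over the shuffle offsets. -/
def cUdx (c w : (Fin 3 × Fin 3) ⊕ Fin 3 → ℤ) (a : Fin 3) : FI :=
  (((FI.ofScaled (c (Sum.inl (a, 0)))).mul (wxFI w 0)).add ((FI.ofScaled (c (Sum.inl (a, 1)))).mul (wxFI w 1))).add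
    ((FI.ofScaled (c (Sum.inl (a, 2)))).mul (wxFI w 2))

/-- `ΔR_k = D·m_k(ξ) + [s_k]·U_c Δξ`, CARTESIAN components `Σ_b D_ab·m_{k,b} + [s_k](U_c Δξ)_a` (not the frame expansion of `rVec`, whose
intermediate coefficients `|f₂| = √(8/3)`, `|hcpShift|` would triple the width). -/
def cDR (c w : (Fin 3 × Fin 3) ⊕ Fin 3 → ℤ) (k : Fin 12) (a : Fin 3) : FI :=
  (sum3 fun b => (wdFI w (a, b)).mul (cM c w k b)).add (if hshift k then cUdx c w a else FI.ofInt 0)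

/-- `‖ΔR_k‖` (enclosure; only `.hi` matters). -/
def cRho (c w : (Fin 3 × Fin 3) ⊕ Fin 3 → ℤ) (k : Fin 12) : FI := FI.sqrt (dot3 (cDR c w k) (cDR c w k))

/-! ## §4. Directional data, the first-order functional, remainders, the pair bound and the verdict -/

/-- `ê_a = r_{c,a}/‖r_c‖` (none if `‖r_c‖` is not certainly positive). -/
def cEh (c : (Fin 3 × Fin 3) ⊕ Fin 3 → ℤ) (L : ℤ) (k k' : Fin 12) (a : Fin 3) : Option FI := FI.divPos (cRcv c L k k' a) (cRcN c L k k')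

/-- `ĝ_a = N_{c,a}/‖N_c‖`. -/
def cGh (c : (Fin 3 × Fin 3) ⊕ Fin 3 → ℤ) (L : ℤ) (k' : Fin 12) (a : Fin 3) : Option FI := FI.divPos (cNc c L k' a) (cNcN c L k')

/-- Three `Option FI` to an `Option (Fin 3 → FI)` (via `Option.bind`, so that proofs use the generic `Option.bind_eq_some` and the kernel never
evaluates the interval data). -/
def vec3? (f : Fin 3 → Option FI) : Option (Fin 3 → FI) :=
  (f 0).bind fun x => (f 1).bind fun y => (f 2).bind fun z => some ![x, y, z]

/-- The `D_ab`-coefficient `ê_a m_{k,b} − en·ĝ_a m_{k′,b}` of the first-order functional. -/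
def cCU (c w : (Fin 3 × Fin 3) ⊕ Fin 3 → ℤ) (k k' : Fin 12) (e g : Fin 3 → FI) (en : FI) (a b : Fin 3) : FI :=
  ((e a).mul (cM c w k b)).sub ((en.mul (g a)).mul (cM c w k' b))

/-- The `Δξ_b`-coefficient `[s_k](U_cᵀ ê)_b − en·[s_{k′}](U_cᵀ ĝ)_b`. -/
def cCX (c : (Fin 3 × Fin 3) ⊕ Fin 3 → ℤ) (k k' : Fin 12) (e g : Fin 3 → FI) (en : FI) (b : Fin 3) : FI :=
  (if hshift k then
      (((FI.ofScaled (c (Sum.inl (0, b)))).mul (e 0)).add ((FI.ofScaled (c (Sum.inl (1, b)))).mul (e 1))).add ((FI.ofScaled (c (Sum.inl (2, b)))).mul (e 2))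
    else FI.ofInt 0).sub
    (en.mul (if hshift k' then
      (((FI.ofScaled (c (Sum.inl (0, b)))).mul (g 0)).add ((FI.ofScaled (c (Sum.inl (1, b)))).mul (g 1))).add ((FI.ofScaled (c (Sum.inl (2, b)))).mul (g 2))
    else FI.ofInt 0))

/-- The entry part of the first-order functional on the SYMMETRIC offset box (`D_ab = D_ba`): diagonal coefficients, and the two coefficients of each
off-diagonal pair COMBINED before the box interval multiplies them (`Σ_a W_aa·C_aa + Σ_{a<b} W_ab·(C_ab + C_ba)`). -/
def cTU (c w : (Fin 3 × Fin 3) ⊕ Fin 3 → ℤ) (k k' : Fin 12) (e g : Fin 3 → FI) (en : FI) : FI :=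
  let C := cCU c w k k' e g en
  let diag := sum3 fun a => (wdFI w (a, a)).mul (C a a)
  let o01 := (wdFI w (0, 1)).mul ((C 0 1).add (C 1 0))
  let o02 := (wdFI w (0, 2)).mul ((C 0 2).add (C 2 0))
  let o12 := (wdFI w (1, 2)).mul ((C 1 2).add (C 2 1))
  ((diag.add o01).add o02).add o12

/-- Sum over the three shuffle offsets of `wxFI·cCX`. -/
def cTX (c w : (Fin 3 × Fin 3) ⊕ Fin 3 → ℤ) (k k' : Fin 12) (e g : Fin 3 → FI) (en : FI) : FI :=
  sum3 fun b => (wxFI w b).mul (cCX c k k' e g en b)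

/-- The CENTRED pair bound from given direction data `e ∋ ê`, `g ∋ ĝ`: `‖r_c‖ + T + |en|·ρ′²/(2(‖N_c‖ − ρ′)) + (ρ+ρ′)²/(2(‖r_c‖ − ρ − ρ′))` as an
interval (none if a remainder guard fails). -/
def cPairCore (c w : (Fin 3 × Fin 3) ⊕ Fin 3 → ℤ) (L : ℤ) (k k' : Fin 12) (e g : Fin 3 → FI) : Option FI :=
  (FI.divPos ((absFI (dot3 e (nbrFI k))).mul (cRho c w k').sqr) (((cNcN c L k').sub (cRho c w k')).mulInt 2)).bind fun q1 =>
    (FI.divPos (((cRho c w k).add (cRho c w k')).sqr) (((cRcN c L k k').sub ((cRho c w k).add (cRho c w k'))).mulInt 2)).bind fun q2 =>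
      some ((((cRcN c L k k').add ((cTU c w k k' e g (dot3 e (nbrFI k))).add (cTX c w k k' e g (dot3 e (nbrFI k))))).add q1).add q2)

/-- The CENTRED pair bound (none if `‖r_c‖` or `‖N_c‖` is not certainly positive or a remainder guard fails). -/
def cPairC (c w : (Fin 3 × Fin 3) ⊕ Fin 3 → ℤ) (L : ℤ) (k k' : Fin 12) : Option FI :=
  (vec3? (cEh c L k k')).bind fun e => (vec3? (cGh c L k')).bind fun g => cPairCore c w L k k' e g

/-- The guard-free triangle bound `‖r_c‖ + ρ_k + ρ_{k′}` (upper ends, scaled). -/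
def cPairT (c w : (Fin 3 × Fin 3) ⊕ Fin 3 → ℤ) (L : ℤ) (k k' : Fin 12) : ℤ := (cRcN c L k k').hi + (cRho c w k).hi + (cRho c w k').hi

/-- The pair test of a scaled bound `B` at threshold `η' = 4999/100000`: `0 ≤ B` and `10¹⁰·B² ≤ 24990001 · d2S · SC` (misfit `≤ η'·d`). -/
def cTest (d2 B : ℤ) : Bool := decide (0 ≤ B) && decide (10000000000 * B ^ 2 ≤ 24990001 * d2 * (SC : ℤ))

/-- The pair test: the triangle bound passes, or the centred bound exists and passes (`Option.elim`, generic lemmas only). -/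
def cPairOK (c w : (Fin 3 × Fin 3) ⊕ Fin 3 → ℤ) (L : ℤ) (k k' : Fin 12) : Bool :=
  cTest (d2S c w L) (cPairT c w L k k') || (cPairC c w L k k').elim false fun B => cTest (d2S c w L) B.hi

/-- ★ **THE DIRECTIONAL CENTRED hcp (P1) FIT VERDICT**: `…HomEntryFitHcpSharpEta.fitOKHSE` with the pair test replaced by `cPairOK` for all `(k, k′)`, plus the
symmetry of the centre entries (the combined off-diagonal coefficients need `D_ab = D_ba`; callers pass `symH c`). -/
def fitOKHD (c w : (Fin 3 × Fin 3) ⊕ Fin 3 → ℤ) : Bool :=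
  let L := scaleL (fun ab => c (Sum.inl ab))
  let D := dEnclH c w
  decide (c (Sum.inl (1, 0)) = c (Sum.inl (0, 1)) ∧ c (Sum.inl (2, 0)) = c (Sum.inl (0, 2)) ∧ c (Sum.inl (2, 1)) = c (Sum.inl (1, 2))) &&
  decide (0 ≤ L) && decide (0 < D.lo) && decide (D.lo ≤ D.hi) && decide (2 * D.hi ≤ 3 * (SC : ℤ)) &&
  decide ((SC : ℤ) ≤ 130 * D.lo) && decide (4 * (xiSq c w).hi ≤ (SC : ℤ)) &&
  K12H.all (fun k => K12H.all fun k' => cPairOK c w L k k') &&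
  K12H.all (fun k => decide ((nbrSq c w k).hi * SC * 10000 ≤ (130 * D.lo - SC) ^ 2)) &&
  decide (∀ b ∈ box7all,
    (b = 0 ∨ (∃ k : Fin 12, hshift k = false ∧ hlab k = b) ∨ (130 * D.hi + (SC : ℤ)) ^ 2 ≤ (qform13 (extU c w) b false).lo * SC * 10000) ∧
    ((∃ k : Fin 12, hshift k = true ∧ hlab k = b) ∨ (130 * D.hi + (SC : ℤ)) ^ 2 ≤ (qform13 (extU c w) b true).lo * SC * 10000))

end Summit.AtomisticToContinuum.Crystallization.Theorems.FrustratedLawDichotomyStrainedPatchHomEntryFitHcpCentred
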